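import Summits.AnomalousDissipation.AnomalousDissipation.Theorems.SawtoothPulseCascadeK1LocalisedCascadeLineRefine

/-!
# K1loc, line `Spectral` — S-D (first good piece): THE LINE REFINEMENT ON THE CASCADE CHORD

Helper file of the prover lane on the crux `K1LocalisedCascade` (stmt-AnomalousDissipation-19491), route
`SawtoothPulseCascade`, registered line `Cruxes.K1LocalisedCascade.Spectral` (one open stub `stub_highModeConcentration`).
`…LineRefine.lineRefine` instantiated on the backward trajectories `z_s` of the chord `s ↦ Y + s e₀` (`z_s n = Y + s e₀`,
`z_s j = S_{H,j} S_{V,j} z_s (j+1)`): V-input `X_j(s) = (z_s (j+1))₀`, H-input `W_j(s) = (z_s (j+1))₁ − γU_j((z_s (j+1))₀)`, zone half-widths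
`ζ₁ = M₁δ_j/(2πN_j)` (corner) and `ζ₂ = M₂δ_j/(2πN_j)` (flat components), the per-piece affinity supplied by `…PieceAffine.piece_affine`.
The smallness hypotheses are SYMBOLIC (the R1 numbers of memo v8 §5/§8): `E_V ≥ Err_ℓ` (all `ℓ < n`),
`E_H ≥ (1+γ)E_V + γη((1+γ+γ²)^n + E_V)` (`η = 2e^{−M₂²/2}`), `ζ₂ + E_V ≤ ζ₁`, `ζ₂ + E_H ≤ ζ₁`, and the potential budget `B`.

* `abs_itinJac_entry_le` — `|(itinJac γ L)₀₀| ≤ (1+γ+γ²)^{|L|}`;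
* `lineRefine_cascade` — at level `n`: finitely many disjoint good pieces in `[0,1]`, total length `≤ 1`,
  `Σ_i |(itinJac γ L_i)₀₀|⁻¹ ≤ B_n`, every uncovered parameter has an input within `ζ₁ + E` of a corner `(m/2 + 1/4)/N_j`.

[cite: ElgindiLissMattingly2025, §1.2.2, §3.1] [problem: turb]
-/

-- `Summit.<Summit>.<Problem>`: single-conjunct summit, the duplicate namespace segment is deliberate.
set_option linter.dupNamespace false

noncomputable section

namespace Summit.AnomalousDissipation.AnomalousDissipation.Theorems.SawtoothPulseCascade.K1Start

open Set Matrix Function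
open Literature.Analysis Literature.Analysis.FunctionSpaces Literature.Analysis.FunctionSpaces.Torus
open Literature.Analysis.FluidPDE.ShearStage
open Literature.Analysis.FluidPDE.SawtoothCascade Literature.Analysis.FluidPDE.SawtoothCascade.CascadeParams

/-- `|(itinJac γ L)₀₀| ≤ (1 + γ + γ²)^{|L|}` (`…AffinePair.norm_itinJac_mulVec_le` on `e₀`). [cite: ElgindiLissMattingly2025, §3.1] -/
theorem abs_itinJac_entry_le {γ : ℝ} (hγ : 0 ≤ γ) {L : List (ℝ × ℝ)} (hL : IsSignList L) :
    |itinJac γ L 0 0| ≤ (1 + γ + γ ^ 2) ^ L.length := by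
  have h := norm_itinJac_mulVec_le hγ hL (Pi.single 0 1)
  rw [Pi.norm_single, norm_one, mul_one] at h
  calc |itinJac γ L 0 0| = ‖(itinJac γ L *ᵥ Pi.single 0 1) 0‖ := by
        rw [Matrix.mulVec_single_one, Matrix.col_apply, Real.norm_eq_abs]
    _ ≤ ‖itinJac γ L *ᵥ Pi.single 0 1‖ := norm_le_pi_norm _ 0
    _ ≤ _ := h

section Cascade

variable (P : CascadeParams)

/-- **The line refinement on the cascade chord** (route (i), memo v8 §8; `…LineRefine.lineRefine` with the cascade inputs and
`…PieceAffine.piece_affine`).  Under the symbolic smallness hypotheses (`hEV`, `hEH`, `hζV`, `hζH`) and the potential budget (`hB0`, `hB`):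
the chord `[0, 1] ∋ s ↦ Y + s e₀` carries finitely many pairwise disjoint GOOD pieces (every input of every phase in an `M₂`-flat component)
of total length `≤ 1`, with `Σ_i |(itinJac γ L_i)₀₀|⁻¹ ≤ B_n`, and every uncovered `s` has some input within `M₁δ_j/(2πN_j) + E` of a corner.
[cite: ElgindiLissMattingly2025, §1.2.2, §3.1] -/
theorem lineRefine_cascade (hγ : 1 ≤ P.γ) (h8 : 8 ≤ P.γ ^ 2) (hδ₀ : 0 < P.δ₀) (hd : 0 < P.d) (hN₀ : 1 ≤ P.N₀) (hρ : 1 ≤ P.ρN)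
    {M₁ M₂ : ℝ} (hM₁ : 0 < M₁) (hM : 1 ≤ M₂) (hMδ : ∀ j, M₂ * P.δ j < Real.pi / 2) {n : ℕ} (Y : EuclideanSpace ℝ (Fin 2))
    (z : ℝ → ℕ → EuclideanSpace ℝ (Fin 2)) (hzn : ∀ s, z s n = Y + s • EuclideanSpace.single 0 1)
    (hz : ∀ s, ∀ j < n, z s j = shearMapLift 0 1 (amp ⟨P.U j, P.U_periodic j, P.contDiff_U (P.δ_pos hδ₀ hd j)⟩ P.γ)
      (shearMapLift 1 0 (amp ⟨P.U j, P.U_periodic j, P.contDiff_U (P.δ_pos hδ₀ hd j)⟩ P.γ) (z s (j + 1))))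
    {EV EH : ℝ} (B : ℕ → ℝ)
    (hEV : ∀ ℓ, ℓ < n → (∑ i ∈ Finset.range ℓ, (1 + P.γ + P.γ ^ 2) ^ i *
        ((P.γ ^ 2 * (1 / (2 * P.N (n - ℓ + i)) - M₂ * P.δ (n - ℓ + i) / (Real.pi * P.N (n - ℓ + i))) +
          P.γ * (1 / (2 * P.N (n - ℓ + i)) - M₂ * P.δ (n - ℓ + i) / (Real.pi * P.N (n - ℓ + i)))) *
          (2 * Real.exp (-(M₂ ^ 2 / 2))))) ≤ EV)
    (hEH : (1 + P.γ) * EV + P.γ * (2 * Real.exp (-(M₂ ^ 2 / 2))) * ((1 + P.γ + P.γ ^ 2) ^ n + EV) ≤ EH)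
    (hζV : ∀ j, M₂ * P.δ j / (2 * Real.pi * P.N j) + EV ≤ M₁ * P.δ j / (2 * Real.pi * P.N j))
    (hζH : ∀ j, M₂ * P.δ j / (2 * Real.pi * P.N j) + EH ≤ M₁ * P.δ j / (2 * Real.pi * P.N j))
    (hB0 : ((P.γ ^ 2 - 3) ^ n)⁻¹ ≤ B 0)
    (hB : ∀ ℓ, ℓ < n → 4 * B ℓ + 2 * P.N (n - ℓ - 1) * (P.γ + 2 + 2 / P.γ) / (P.γ ^ 2 - 3) ^ (n - ℓ) ≤ B (ℓ + 1)) :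
    ∃ (ι : Type) (S : Finset ι) (u v : ι → ℝ) (pV pH : ι → ℕ → ℤ),
      (∀ i ∈ S, u i ≤ v i ∧ Icc (u i) (v i) ⊆ Icc (0 : ℝ) 1) ∧
      (∀ i ∈ S, ∀ i' ∈ S, i ≠ i' → Disjoint (Icc (u i) (v i)) (Icc (u i') (v i'))) ∧
      (∑ i ∈ S, (v i - u i) ≤ 1) ∧
      (∀ i ∈ S, ∀ s ∈ Icc (u i) (v i), ∀ j', n - n ≤ j' → j' < n →
        (z s (j' + 1)) 0 ∈ Icc ((((pV i j' : ℤ) : ℝ) / 2 - 1 / 4) / P.N j' + M₂ * P.δ j' / (2 * Real.pi * P.N j'))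
          ((((pV i j' : ℤ) : ℝ) / 2 + 1 / 4) / P.N j' - M₂ * P.δ j' / (2 * Real.pi * P.N j')) ∧
        ((z s (j' + 1)) 1 - P.γ * P.U j' ((z s (j' + 1)) 0)) ∈
          Icc ((((pH i j' : ℤ) : ℝ) / 2 - 1 / 4) / P.N j' + M₂ * P.δ j' / (2 * Real.pi * P.N j'))
          ((((pH i j' : ℤ) : ℝ) / 2 + 1 / 4) / P.N j' - M₂ * P.δ j' / (2 * Real.pi * P.N j'))) ∧
      (∑ i ∈ S, ((P.γ ^ 2 - 3) ^ (n - n) * |itinJac P.γ ((List.range n).map fun k =>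
            (-(1 - 2 * ((pH i (n - n + k) % 2 : ℤ) : ℝ)), -(1 - 2 * ((pV i (n - n + k) % 2 : ℤ) : ℝ)))) 0 0|)⁻¹ ≤ B n) ∧
      (∀ s ∈ Icc (0 : ℝ) 1, (∃ i ∈ S, s ∈ Icc (u i) (v i)) ∨
        ∃ j', n - n ≤ j' ∧ j' < n ∧ ∃ m : ℤ,
          |(z s (j' + 1)) 0 - ((m : ℝ) / 2 + 1 / 4) / P.N j'| < M₁ * P.δ j' / (2 * Real.pi * P.N j') + EV ∨
          |((z s (j' + 1)) 1 - P.γ * P.U j' ((z s (j' + 1)) 0)) - ((m : ℝ) / 2 + 1 / 4) / P.N j'| <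
            M₁ * P.δ j' / (2 * Real.pi * P.N j') + EH) := by
  have hγ0 : 0 < P.γ := by linarith
  have hN : ∀ j, 0 < P.N j := P.N_pos hN₀ hρ
  have hζ₁ : ∀ j, 0 < M₁ * P.δ j / (2 * Real.pi * P.N j) := fun j => by
    have := P.δ_pos hδ₀ hd j
    have := hN j
    positivity
  refine lineRefine P.N (fun j => M₁ * P.δ j / (2 * Real.pi * P.N j)) (fun j => M₂ * P.δ j / (2 * Real.pi * P.N j))
    (fun j' s => (z s (j' + 1)) 0) (fun j' s => (z s (j' + 1)) 1 - P.γ * P.U j' ((z s (j' + 1)) 0)) B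
    hγ0 h8 hN hζ₁ hζV hζH hB0 hB ?_ n le_rfl
  intro ℓ hℓ u v pV pH huv hsub hgood'
  dsimp only at hgood' ⊢
  have e1 : n - ℓ - 1 + 1 = n - ℓ := by omega
  have e2 : n - (n - ℓ) = ℓ := by omega
  have hpa := piece_affine P hγ hδ₀ hd hN₀ hρ hM hMδ (n := n) (j := n - ℓ - 1) (by omega) Y z hzn hz (u := u) (v := v)
    pV pH (fun s hs j' hj1 hj2 => hgood' s hs j' (by omega) hj2)
    (J := itinJac P.γ ((List.range ℓ).map fun k =>
            (-(1 - 2 * ((pH (n - ℓ + k) % 2 : ℤ) : ℝ)), -(1 - 2 * ((pV (n - ℓ + k) % 2 : ℤ) : ℝ))))) (by rw [e1, e2])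
    (Err := (∑ i ∈ Finset.range ℓ, (1 + P.γ + P.γ ^ 2) ^ i *
        ((P.γ ^ 2 * (1 / (2 * P.N (n - ℓ + i)) - M₂ * P.δ (n - ℓ + i) / (Real.pi * P.N (n - ℓ + i))) +
          P.γ * (1 / (2 * P.N (n - ℓ + i)) - M₂ * P.δ (n - ℓ + i) / (Real.pi * P.N (n - ℓ + i)))) *
          (2 * Real.exp (-(M₂ ^ 2 / 2)))))) (by rw [e1, e2])
  obtain ⟨hV, hH⟩ := hpa
  have hvu1 : v - u ≤ 1 := by
    have h0 := hsub (left_mem_Icc.mpr huv)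
    have h1 := hsub (right_mem_Icc.mpr huv)
    linarith [h0.1, h1.2]
  have hERR := hEV ℓ hℓ
  have hsl := isSignList_pieceItin pV pH (n - ℓ) ℓ
  have hJ : |itinJac P.γ ((List.range ℓ).map fun k =>
            (-(1 - 2 * ((pH (n - ℓ + k) % 2 : ℤ) : ℝ)), -(1 - 2 * ((pV (n - ℓ + k) % 2 : ℤ) : ℝ)))) 0 0| ≤ (1 + P.γ + P.γ ^ 2) ^ n := by
    refine (abs_itinJac_entry_le hγ0.le hsl.1).trans ?_
    rw [hsl.2]
    exact pow_le_pow_right₀ (by nlinarith) hℓ.le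
  refine ⟨fun s hs s' hs' => (hV s hs s' hs').trans hERR,
    fun p a b hab hmem s hs s' hs' => (hH p a b hab hmem s hs s' hs').trans ?_⟩
  have hE0 : 0 ≤ (∑ i ∈ Finset.range ℓ, (1 + P.γ + P.γ ^ 2) ^ i *
        ((P.γ ^ 2 * (1 / (2 * P.N (n - ℓ + i)) - M₂ * P.δ (n - ℓ + i) / (Real.pi * P.N (n - ℓ + i))) +
          P.γ * (1 / (2 * P.N (n - ℓ + i)) - M₂ * P.δ (n - ℓ + i) / (Real.pi * P.N (n - ℓ + i)))) *
          (2 * Real.exp (-(M₂ ^ 2 / 2))))) :=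
    (abs_nonneg _).trans (hV u (left_mem_Icc.mpr huv) u (left_mem_Icc.mpr huv))
  have h1 : |itinJac P.γ ((List.range ℓ).map fun k =>
            (-(1 - 2 * ((pH (n - ℓ + k) % 2 : ℤ) : ℝ)), -(1 - 2 * ((pV (n - ℓ + k) % 2 : ℤ) : ℝ)))) 0 0| * (v - u) ≤ (1 + P.γ + P.γ ^ 2) ^ n :=
    (mul_le_mul_of_nonneg_left hvu1 (abs_nonneg _)).trans (by rw [mul_one]; exact hJ)
  refine le_trans ?_ hEH
  gcongr

end Cascade

end Summit.AnomalousDissipation.AnomalousDissipation.Theorems.SawtoothPulseCascade.K1Start
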